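import Summits.Ventures.CertifiedManyBodySolver.Transport.LTIPrimalPrelude
import Literature.MathematicalPhysics.QuantumLattice.HubbardJordanWignerLocality
import Literature.MathematicalPhysics.QuantumLattice.HubbardWindowCertificate
import HarnessLib

/-!
# Ventures/CertifiedManyBodySolver — Transport/LTIPrimalHubbardPrelude.lean

Speedrun cell sr-mbsolver — LIT team (lit-1 gen-5), D-16 r36 / D-18 r72(c).
HONEST FRAMING: first certified bounds; not a superconductivity verdict; every number certified or labelled float.

General lemmas for the PRIMAL (by-value) transport of lane-B `relax = lti(n)` rows with FERMION statistics
(`Transport/LTIPrimalHubbardChain.lean`, the fermion twin of lit-4's `LTIPrimalSpinChain.lean`); nothing here is specific to a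
certificate. (1) REAL ENTRIES: entrywise complex conjugation commutes with the CAR isotony `Γ(φ)` (`fermionEmbed_map_conj`, by
`algHom_ext_car` applied to `a ↦ conj (Γ (conj a))`) and with the Jordan–Wigner reading `toSpin`; the Hubbard interaction and its
mean-energy observable are real Hermitian matrices. (2) SPIN-`σ` NUMBERS: `[N_σ, Γ_φ(a)] = Γ_φ([N_σ, a])` (the number operators
outside the range are even, hence commute with the embedded algebra — graded locality, `commute_of_mem_carEvenSubalgebra`), and
`N_σ` is diagonal in the Fock basis with eigenvalue the `σ`-count of the configuration, which in the product basis `|k⟩` is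
`Σ_x [σ ∈ siteOcc (k x)]`. (3) transposes pass through a general `spinPartialTrace`. Also the site-level short-circuit instance `DecidableEq (PolySite Λ) := LinearOrder.toDecidableEq` (companion of THE
MODEL's `PolySite.instDecidableEqOrb`), so that every file elaborates the window qudit space `Op (PolySite Λ') 4` with the instance
the order-generic lemmas carry. [cite: ArakiMoriya2003, §4.1] [cite: EsslerEtAl2005, §12.3.4] [cite: KullEtAl2024, §II.B]
-/

noncomputable section

open Matrix Complex Filter Topology
open scoped ComplexOrder
open Literature.Probability.LatticeModels
open Literature.MathematicalPhysics.QuantumLattice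
open Literature.MathematicalPhysics.QuantumLattice.HubbardWave0
open Literature.MathematicalPhysics.QuantumLattice.ThermodynamicLimit
open Literature.MathematicalPhysics.QuantumLattice.JordanWigner
open Literature.MathematicalPhysics.QuantumManyBody.StateRelaxation

namespace Summit.Ventures.CertifiedManyBodySolver.Transport

/-- Short-circuit instance (the site-level companion of THE MODEL's `PolySite.instDecidableEqOrb`): equality of the SITES of a
region `Λ ⊆ ℤ^d` is decided through their linear (lexicographic) order — the instance every order-generic lemma over
`TensorIndex (PolySite Λ) 4` (`toSpin`, `quditDensity`, `spinPartialTrace`, `Op (PolySite Λ) 4` itself) carries. A file stating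
a by-value node over `Op (PolySite Λ') 4` imports this file (to apply the transport below), so both sides elaborate the window
qudit space with the same instance. [folklore] -/
instance (priority := high) instDecidableEqPolySite {d : ℕ} (Λ : Finset (Site d)) : DecidableEq (PolySite Λ) :=
  LinearOrder.toDecidableEq

/-! ### Real entries: conjugation commutes with the CAR isotony, with `toSpin`, and fixes the Hubbard interaction -/

section RealEntries

variable {Λ Λ' : Type*} [LinearOrder Λ] [Fintype Λ] [LinearOrder Λ'] [Fintype Λ']

/-- The Jordan–Wigner annihilation matrices are real (entries `0, ±1`). [folklore] -/
private theorem annihilation_map_conj' {ι : Type*} [LinearOrder ι] (i : ι) :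
    (annihilation i : Matrix (Finset ι) (Finset ι) ℂ).map (starRingEnd ℂ) = annihilation i := by
  ext s t
  simp only [map_apply, annihilation_apply]
  split_ifs <;> simp [jwSign]

/-- The Jordan–Wigner creation matrices are real (entries `0, ±1`). [folklore] -/
private theorem creation_map_conj' {ι : Type*} [LinearOrder ι] (i : ι) :
    (creation i : Matrix (Finset ι) (Finset ι) ℂ).map (starRingEnd ℂ) = creation i := by
  ext s t
  simp only [map_apply, creation_apply]
  split_ifs <;> simp [jwSign]

/-- The number operators `n_{xσ} = c†_{xσ} c_{xσ}` are real matrices. [folklore] -/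
theorem numberOp_map_conj (x : Λ) (σ : Fin 2) :
    (numberOp x σ : Matrix (Finset (Orb Λ)) (Finset (Orb Λ)) ℂ).map (starRingEnd ℂ) = numberOp x σ := by
  rw [numberOp, Matrix.map_mul, creation_map_conj', annihilation_map_conj']

/-- A guarded term under entrywise conjugation. [folklore] -/
private theorem map_conj_ite' {ι : Type*} (p : Prop) [Decidable p] (M : Matrix ι ι ℂ) :
    (if p then M else 0).map (starRingEnd ℂ) = if p then M.map (starRingEnd ℂ) else 0 := by
  split_ifs
  · rfl
  · exact Matrix.map_zero _ (map_zero _)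

/-- **Entrywise complex conjugation commutes with the CAR isotony `Γ(φ)`**: `conj ∘ Γ(φ) ∘ conj` is a unital algebra
homomorphism agreeing with `Γ(φ)` on the (real) generators `c_i, c†_i`, hence equal to it (`algHom_ext_car`).
[cite: ArakiMoriya2003, §4.1 Def. 4.1–4.3] [cite: BratteliRobinsonII1997, §5.2.2 Thm. 5.2.5] -/
theorem fermionEmbed_map_conj (φ : Λ ↪ Λ') (a : Matrix (Finset (Orb Λ)) (Finset (Orb Λ)) ℂ) :
    (fermionEmbed φ a).map (starRingEnd ℂ) = fermionEmbed φ (a.map (starRingEnd ℂ)) := by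
  classical
  have hcc : (a.map (starRingEnd ℂ)).map (starRingEnd ℂ) = a := by
    ext i j
    simp only [map_apply, starRingEnd_self_apply]
  -- entrywise conjugation as ring homomorphisms, and the conjugate-sandwiched homomorphism `a ↦ conj (Γ (conj a))`
  let κ₁ : Matrix (Finset (Orb Λ)) (Finset (Orb Λ)) ℂ →+* Matrix (Finset (Orb Λ)) (Finset (Orb Λ)) ℂ :=
    (starRingEnd ℂ).mapMatrix
  let κ₂ : Matrix (Finset (Orb Λ')) (Finset (Orb Λ')) ℂ →+* Matrix (Finset (Orb Λ')) (Finset (Orb Λ')) ℂ :=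
    (starRingEnd ℂ).mapMatrix
  let G : Matrix (Finset (Orb Λ)) (Finset (Orb Λ)) ℂ →ₐ[ℂ] Matrix (Finset (Orb Λ')) (Finset (Orb Λ')) ℂ :=
    { κ₂.comp ((fermionEmbed φ).toRingHom.comp κ₁) with
      commutes' := fun c => by
        show ((fermionEmbed φ ((algebraMap ℂ (Matrix (Finset (Orb Λ)) (Finset (Orb Λ)) ℂ) c).map
            (starRingEnd ℂ))).map (starRingEnd ℂ)) = algebraMap ℂ (Matrix (Finset (Orb Λ')) (Finset (Orb Λ')) ℂ) c
        rw [Algebra.algebraMap_eq_smul_one, Algebra.algebraMap_eq_smul_one, map_conj_smul,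
          Matrix.map_one _ (map_zero _) (map_one _), fermionEmbed_smul, map_one, map_conj_smul,
          Matrix.map_one _ (map_zero _) (map_one _), starRingEnd_self_apply] }
  have hG : ∀ b, G b = (fermionEmbed φ (b.map (starRingEnd ℂ))).map (starRingEnd ℂ) := fun b => rfl
  have hGΓ : G = fermionEmbed φ := by
    refine algHom_ext_car (fun i => ?_) (fun i => ?_)
    · rw [hG, annihilation_map_conj', fermionEmbed_annihilation', annihilation_map_conj']
    · rw [hG, creation_map_conj', fermionEmbed_creation', creation_map_conj']
  have h : G (a.map (starRingEnd ℂ)) = fermionEmbed φ (a.map (starRingEnd ℂ)) := by rw [hGΓ]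
  rw [hG, hcc] at h
  exact h

/-- `toSpin` is entrywise (a relabelling of the Fock basis): it commutes with entrywise maps.
[cite: EsslerEtAl2005, §12.3.4 eq. (12.196)] -/
theorem toSpin_map (A : Matrix (Finset (Orb Λ)) (Finset (Orb Λ)) ℂ) (f : ℂ → ℂ) :
    (toSpin A).map f = toSpin (A.map f) := by
  ext k k'
  simp only [map_apply, toSpin_apply]

/-- `toSpin` commutes with transposition. [cite: EsslerEtAl2005, §12.3.4 eq. (12.196)] -/
theorem toSpin_transpose (A : Matrix (Finset (Orb Λ)) (Finset (Orb Λ)) ℂ) : (toSpin A)ᵀ = toSpin Aᵀ := by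
  ext k k'
  simp only [transpose_apply, toSpin_apply]

/-- `toSpin⁻¹` of a matrix unit of the product basis is the Fock matrix unit of the occupied sets.
[cite: EsslerEtAl2005, §12.3.4 eq. (12.196)] -/
theorem toSpin_symm_single (s t : TensorIndex Λ 4) (c : ℂ) :
    (toSpin (Λ := Λ)).symm (Matrix.single s t c) = Matrix.single (config s) (config t) c := by
  apply (toSpin (Λ := Λ)).injective
  rw [AlgEquiv.apply_symm_apply]
  ext k k'
  rw [toSpin_apply, Matrix.single_apply, Matrix.single_apply]
  by_cases h : s = k ∧ t = k'
  · rw [if_pos h, if_pos ⟨congrArg config h.1, congrArg config h.2⟩]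
  · rw [if_neg h, if_neg fun h' =>
      h ⟨(JordanWigner.configEquiv (Λ := Λ)).injective h'.1, (JordanWigner.configEquiv (Λ := Λ)).injective h'.2⟩]

/-- **The Hubbard interaction has real matrices** (`t, U` real; the `c, c†, n` matrices are real). [cite: arXiv9311033, §2] -/
theorem hubbardFermionInteraction_map_conj {d : ℕ} (t U : ℝ) (X : Finset (Site d)) :
    ((hubbardFermionInteraction d t U).Φ X).map (starRingEnd ℂ) = (hubbardFermionInteraction d t U).Φ X := by
  have hn : ∀ (x : Site d) (hx : x ∈ X),
      (nAt x hx 0 * nAt x hx 1 : FermionOp X).map (starRingEnd ℂ) = nAt x hx 0 * nAt x hx 1 := by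
    intro x hx
    rw [Matrix.map_mul, nAt, nAt, numberOp_map_conj, numberOp_map_conj]
  have hc : ∀ (x y : Site d) (hx : x ∈ X) (hy : y ∈ X) (σ : Fin 2),
      ((cAt x hx σ)ᴴ * cAt y hy σ + (cAt y hy σ)ᴴ * cAt x hx σ : FermionOp X).map (starRingEnd ℂ) =
        (cAt x hx σ)ᴴ * cAt y hy σ + (cAt y hy σ)ᴴ * cAt x hx σ := by
    intro x y hx hy σ
    rw [cAt, cAt, annihilation_conjTranspose, annihilation_conjTranspose, map_conj_add, Matrix.map_mul, Matrix.map_mul,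
      creation_map_conj', annihilation_map_conj', creation_map_conj', annihilation_map_conj']
  simp only [hubbardFermionInteraction, map_conj_add, map_conj_sum, map_conj_ite', map_conj_smul, hn, hc,
    Complex.conj_ofReal, map_neg]

/-- The mean-energy observable `E_Φ` of the Hubbard interaction is a real matrix. [cite: BratteliKishimotoRobinson1978, §3] -/
theorem hubbard_meanEnergyObs_map_conj {d : ℕ} (t U R : ℝ) :
    ((hubbardFermionInteraction d t U).meanEnergyObs R).map (starRingEnd ℂ) =
      (hubbardFermionInteraction d t U).meanEnergyObs R := by
  unfold FermionInteraction.meanEnergyObs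
  rw [map_conj_sum]
  refine Finset.sum_congr rfl fun X _ => ?_
  rw [map_conj_smul, fermionEmbed_map_conj, hubbardFermionInteraction_map_conj, map_inv₀, map_natCast]

/-- The mean-energy observable `E_Φ` of the Hubbard interaction is Hermitian. [cite: BratteliKishimotoRobinson1978, §3] -/
theorem hubbard_meanEnergyObs_isHermitian {d : ℕ} (t U R : ℝ) :
    ((hubbardFermionInteraction d t U).meanEnergyObs R).IsHermitian := by
  unfold FermionInteraction.meanEnergyObs Matrix.IsHermitian
  rw [Matrix.conjTranspose_sum]
  refine Finset.sum_congr rfl fun X _ => ?_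
  rw [Matrix.conjTranspose_smul, ← fermionEmbed_conjTranspose, (hubbardFermionInteraction_isHermitian t U _).eq,
    Complex.star_def, map_inv₀, map_natCast]

end RealEntries

/-! ### Spin-`σ` numbers: commutators through the isotony, and the product basis -/

section SpinNumber

variable {Λ Λ' : Type*} [LinearOrder Λ] [Fintype Λ] [LinearOrder Λ'] [Fintype Λ']

/-- **`[N_σ, Γ_φ(a)] = Γ_φ([N_σ, a])`**: the spin-`σ` number of `Λ'` is the embedded spin-`σ` number of `Λ` plus number
operators OUTSIDE the range of `φ`, which are even and hence commute with `Γ_φ(𝔄_Λ)` (graded locality,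
`commute_of_mem_carEvenSubalgebra`). [cite: ArakiMoriya2003, §4.1–4.2] [cite: BratteliRobinsonII1997, §5.2.2] -/
theorem sum_numberOp_commutator_fermionEmbed (φ : Λ ↪ Λ') (σ : Fin 2)
    (a : Matrix (Finset (Orb Λ)) (Finset (Orb Λ)) ℂ) :
    (∑ y : Λ', numberOp y σ) * fermionEmbed φ a - fermionEmbed φ a * (∑ y : Λ', numberOp y σ) =
      fermionEmbed φ ((∑ x : Λ, numberOp x σ) * a - a * (∑ x : Λ, numberOp x σ)) := by
  classical
  -- number operators outside the range commute with the embedded algebra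
  have hout : ∀ y : Λ', y ∉ Set.range φ →
      (numberOp y σ : Matrix (Finset (Orb Λ')) (Finset (Orb Λ')) ℂ) * fermionEmbed φ a =
        fermionEmbed φ a * numberOp y σ := by
    intro y hy
    refine (commute_of_mem_carEvenSubalgebra (S₁ := orbs ({y} : Finset Λ'))
      (numberOp_mem_carEvenSubalgebra (orb_mem_orbs.2 (Finset.mem_singleton_self y)))
      (fermionEmbed_mem_carSubalgebra φ a) ?_).eq
    rw [Finset.disjoint_left]
    intro i hi hi'
    have h1 : (ofLex i).1 = y := Finset.mem_singleton.1 (mem_orbs.1 hi)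
    obtain ⟨x, -, hx⟩ := Finset.mem_map.1 (mem_orbs.1 hi')
    exact hy ⟨x, hx.trans h1⟩
  -- split the spin-`σ` number of `Λ'` along the range of `φ`
  have hsplit : (∑ y : Λ', numberOp y σ : Matrix (Finset (Orb Λ')) (Finset (Orb Λ')) ℂ) =
      fermionEmbed φ (∑ x : Λ, numberOp x σ) +
        ∑ y ∈ (Finset.univ : Finset Λ').filter (fun y => y ∉ Set.range φ), numberOp y σ := by
    rw [map_sum]
    simp_rw [fermionEmbed_numberOp]
    rw [← Finset.sum_map Finset.univ φ (fun y => (numberOp y σ : Matrix (Finset (Orb Λ')) (Finset (Orb Λ')) ℂ)),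
      ← Finset.sum_filter_add_sum_filter_not Finset.univ (fun y : Λ' => y ∈ Set.range φ)]
    congr 1
    refine Finset.sum_congr ?_ fun _ _ => rfl
    ext y
    simp only [Finset.mem_filter, Finset.mem_univ, true_and, Finset.mem_map, Set.mem_range]
  have hR : (∑ y ∈ (Finset.univ : Finset Λ').filter (fun y => y ∉ Set.range φ), numberOp y σ) * fermionEmbed φ a =
      fermionEmbed φ a * ∑ y ∈ (Finset.univ : Finset Λ').filter (fun y => y ∉ Set.range φ), numberOp y σ := by
    rw [Finset.sum_mul, Finset.mul_sum]
    refine Finset.sum_congr rfl fun y hy => ?_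
    exact hout y (Finset.mem_filter.1 hy).2
  rw [hsplit, add_mul, mul_add, hR, map_sub, map_mul, map_mul]
  abel

/-- **`N_σ` is diagonal in the Fock basis**, with eigenvalue the number of occupied `σ`-orbitals. [cite: LiebPRL1989, eq. (2)] -/
theorem sum_numberOp_eq_diagonal (σ : Fin 2) :
    (∑ x : Λ, numberOp x σ : Matrix (Finset (Orb Λ)) (Finset (Orb Λ)) ℂ) =
      diagonal fun s => ∑ x : Λ, if orb x σ ∈ s then (1 : ℂ) else 0 := by
  classical
  have h : ∀ x : Λ, (numberOp x σ : Matrix (Finset (Orb Λ)) (Finset (Orb Λ)) ℂ) =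
      diagonal fun s => if orb x σ ∈ s then (1 : ℂ) else 0 := fun x => by
    rw [← numberAt_orb, numberAt_eq_diagonal]
  ext s t
  simp only [Matrix.sum_apply, h, diagonal_apply]
  split_ifs with hst
  · rfl
  · simp

/-- The number of occupied `σ`-orbitals of the configuration `k`, counted in the Fock basis and in the product basis.
[cite: EsslerEtAl2005, §12.3.4 eq. (12.196)] -/
theorem sum_ite_orb_mem_config (σ : Fin 2) (k : TensorIndex Λ 4) :
    (∑ x : Λ, if orb x σ ∈ config k then (1 : ℂ) else 0) =
      ((∑ x : Λ, if σ ∈ siteOcc (k x) then 1 else 0 : ℕ) : ℂ) := by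
  push_cast
  refine Finset.sum_congr rfl fun x _ => ?_
  simp only [orb_mem_config]

end SpinNumber

/-! ### Transposes through a general partial trace -/

section Transpose

variable {X Y : Type*} [Fintype X] [DecidableEq X] [Fintype Y] [DecidableEq Y] {q : ℕ}

/-- `Γ_φ (Aᵀ) = (Γ_φ A)ᵀ` for the spin isotony. [cite: BratteliRobinsonII1997, §6.2.1] -/
theorem spinEmbed_transpose (φ : X ↪ Y) (A : Op X q) : (spinEmbed φ A)ᵀ = spinEmbed φ Aᵀ := by
  ext σ τ
  rw [transpose_apply, spinEmbed_apply, spinEmbed_apply, transpose_apply]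
  by_cases h : ∀ y, y ∉ Set.range φ → τ y = σ y
  · rw [if_pos h, if_pos fun y hy => (h y hy).symm]
  · rw [if_neg h, if_neg fun h' => h fun y hy => (h' y hy).symm]

/-- `tr_{Y∖X} (ρᵀ) = (tr_{Y∖X} ρ)ᵀ` for a general site injection. [cite: NielsenChuang2010, §2.4.3] -/
theorem spinPartialTrace_transpose (φ : X ↪ Y) (ρ : Op Y q) :
    spinPartialTrace φ ρᵀ = (spinPartialTrace φ ρ)ᵀ := by
  ext t s
  rw [transpose_apply, spinPartialTrace_apply, spinPartialTrace_apply, ← trace_transpose, transpose_mul,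
    transpose_transpose, spinEmbed_transpose, Matrix.transpose_single, trace_mul_comm]

end Transpose


end Summit.Ventures.CertifiedManyBodySolver.Transport
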